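import Literature.Analysis.Asymptotics.MonomialSublevelAsymptotics
import Literature.Probability.Distributions.GaussianPiDensity
import HarnessLib

/-!
# Normalised moments of the sublevel sets of a monomial

Preparation for the amplitude version of the elementary (monomial) asymptotics
(Lin 2017, Prop. 2.1 with a smooth amplitude `φ`, `φ(0) > 0`; AGV II §7.2, Lemma 7.5 (1)): with
`vol_w = ∏_j x_j^{w_j-1} dx_j` on the cube `(0,1]^d`, `A_t = {∏ x_j^{κ_j} ≤ t}` and the scale
`N(t) = t^λ (log 1/t)^{θ-1}` of `tendsto_sublevelVolume` (`λ = rlct κ w`, `θ = rlctMult κ w`),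
every monomial moment `∫_{A_t} x^n dvol_w / N(t)` converges as `t → 0⁺` to a limit `c_n ≥ 0`
(`tendsto_moment`).  Indeed `x^n dvol_w = dvol_{w+n}` (`setIntegral_monomial_eq`) and the exponent
pair of the shifted weight is lexicographically not smaller: `λ(w+n) ≥ λ(w)` with
`θ(w+n) ≤ θ(w)` in case of equality (`rlct_le_rlct_add`, `rlctMult_add_le`).

Everything is PROVED; no definitions, no named facts.

## References

* S. Lin, arXiv:1003.5338, Prop. 2.1. [Lin2017]
* V. I. Arnold, S. M. Gusein-Zade, A. N. Varchenko, *Singularities of Differentiable Maps II*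
  (2012), Part II §7.2, Lemmas 7.3–7.5. [ArnoldGuseinzadeVarchenko2012]
-/

noncomputable section

open MeasureTheory Filter Set Topology

open scoped ENNReal

namespace Literature.Analysis.Asymptotics.MonomialPhase

variable {d : ℕ}

/-! ## Shifting the weight by a monomial -/

/-- `x^n · x^{ω-1} dx = x^{ω+n-1} dx` on `(0,1]`. [folklore] -/
theorem powMeasure_withDensity_pow (ω : ℝ) (n : ℕ) :
    (powMeasure ω).withDensity (fun x => ENNReal.ofReal (x ^ n)) = powMeasure (ω + n) := by
  rw [powMeasure_def, powMeasure_def, ← withDensity_mul _ (by fun_prop) (by fun_prop)]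
  refine withDensity_congr_ae ?_
  rw [Filter.EventuallyEq, ae_restrict_iff' measurableSet_Ioc]
  refine ae_of_all _ fun x hx => ?_
  simp only [Pi.mul_apply]
  rw [← ENNReal.ofReal_mul (Real.rpow_nonneg hx.1.le _),
    show ω + n - 1 = (ω - 1) + n by ring, Real.rpow_add_natCast hx.1.ne']

/-- `⊗ᵢ (fᵢ μᵢ) = (∏ᵢ fᵢ(xᵢ)) · ⊗ᵢ μᵢ` over `Fin d`. [folklore] -/
theorem pi_withDensity_fin (μ : Fin d → Measure ℝ) [∀ i, SigmaFinite (μ i)]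
    (f : Fin d → ℝ → ℝ≥0∞) (hf : ∀ i, Measurable (f i))
    [∀ i, SigmaFinite ((μ i).withDensity (f i))] :
    Measure.pi (fun i => (μ i).withDensity (f i)) =
      (Measure.pi μ).withDensity fun x => ∏ i, f i (x i) := by
  refine Measure.pi_eq fun s hs => ?_
  rw [withDensity_apply _ (MeasurableSet.univ_pi hs), Measure.restrict_pi_pi,
    Literature.Probability.Distributions.lintegral_fin_nat_prod_eq_prod _ _ (fun i => hf i)]
  exact Finset.prod_congr rfl fun i _ => (withDensity_apply _ (hs i)).symm

/-- `(∏ x_j^{n_j}) · vol_w = vol_{w+n}`. [folklore] -/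
theorem pi_powMeasure_withDensity {w : Fin d → ℝ} (hw : ∀ j, 0 < w j) (n : Fin d → ℕ) :
    (Measure.pi fun j => powMeasure (w j)).withDensity
        (fun x => ∏ j, ENNReal.ofReal (x j ^ n j)) =
      Measure.pi fun j => powMeasure (w j + n j) := by
  haveI := sigmaFinite_powMeasure hw
  have hw' : ∀ j, 0 < w j + n j := fun j => add_pos_of_pos_of_nonneg (hw j) (Nat.cast_nonneg _)
  haveI : ∀ j, SigmaFinite ((powMeasure (w j)).withDensity fun x => ENNReal.ofReal (x ^ n j)) :=
    fun j => by
      rw [powMeasure_withDensity_pow]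
      exact sigmaFinite_powMeasure hw' j
  have h := pi_withDensity_fin (fun j => powMeasure (w j)) (fun j x => ENNReal.ofReal (x ^ n j))
    (fun j => by fun_prop)
  rw [← h]
  congr 1
  funext j
  exact powMeasure_withDensity_pow (w j) (n j)

/-- `vol_w`-almost every point lies in the cube `(0,1]^d`. [folklore] -/
theorem ae_mem_cube {w : Fin d → ℝ} (hw : ∀ j, 0 < w j) :
    ∀ᵐ x ∂(Measure.pi fun j => powMeasure (w j)), x ∈ Set.pi univ fun _ => Ioc (0 : ℝ) 1 := by
  have hm : MeasurableSet (Set.pi univ fun _ : Fin d => Ioc (0 : ℝ) 1) :=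
    MeasurableSet.univ_pi fun _ => measurableSet_Ioc
  rw [ae_iff]
  have h := pi_powMeasure_apply_eq_inter hw _ hm.compl
  rw [compl_inter_self, measure_empty] at h
  exact h

/-- **Moment identity**: `∫_A x^n dvol_w = vol_{w+n}(A)`. [folklore] -/
theorem setIntegral_monomial_eq {w : Fin d → ℝ} (hw : ∀ j, 0 < w j) (n : Fin d → ℕ)
    {A : Set (Fin d → ℝ)} (hA : MeasurableSet A) :
    ∫ x in A, ∏ j, x j ^ n j ∂(Measure.pi fun j => powMeasure (w j)) =
      ((Measure.pi fun j => powMeasure (w j + n j)) A).toReal := by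
  have hnn : ∀ᵐ x ∂(Measure.pi fun j => powMeasure (w j)), ∀ j, 0 ≤ x j ^ n j :=
    (ae_mem_cube hw).mono fun x hx j => pow_nonneg (hx j (mem_univ j)).1.le _
  rw [integral_eq_lintegral_of_nonneg_ae ((ae_restrict_of_ae hnn).mono fun x hx =>
      Finset.prod_nonneg fun j _ => hx j) (Measurable.aestronglyMeasurable (by fun_prop)),
    ← pi_powMeasure_withDensity hw n, withDensity_apply _ hA]
  congr 1
  refine lintegral_congr_ae ((ae_restrict_of_ae hnn).mono fun x hx => ?_)
  exact ENNReal.ofReal_prod_of_nonneg fun j _ => hx j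

/-! ## The exponent pair of a shifted weight -/

variable {κ : Fin d → ℕ} {w : Fin d → ℝ}

/-- `λ(w) ≤ λ(w + n)`. [folklore] -/
theorem rlct_le_rlct_add (hκ : κ ≠ 0) (hw : ∀ j, 0 < w j) (n : Fin d → ℕ) :
    rlct κ w ≤ rlct κ (fun j => w j + n j) := by
  obtain ⟨j, hj, hjeq⟩ := exists_rlct_eq (w := fun j => w j + n j) hκ
  rw [hjeq]
  refine (rlct_le hj).trans ?_
  have hκj : (0 : ℝ) < κ j := by exact_mod_cast Nat.pos_of_ne_zero hj
  have := hw j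
  exact div_le_div_of_nonneg_right (by simp) hκj.le

/-- If `λ(w + n) = λ(w)` then `θ(w + n) ≤ θ(w)`. [folklore] -/
theorem rlctMult_add_le (n : Fin d → ℕ) (h : rlct κ (fun j => w j + n j) = rlct κ w) :
    rlctMult κ (fun j => w j + n j) ≤ rlctMult κ w := by
  rw [rlctMult, rlctMult]
  refine Finset.card_le_card fun j hj => ?_
  simp only [Finset.mem_filter, Finset.mem_univ, true_and] at hj ⊢
  refine ⟨hj.1, le_antisymm ?_ (rlct_le hj.1)⟩
  have hκj : (0 : ℝ) < κ j := by exact_mod_cast Nat.pos_of_ne_zero hj.1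
  calc w j / κ j ≤ (w j + n j) / κ j := div_le_div_of_nonneg_right (by simp) hκj.le
    _ = rlct κ w := by rw [hj.2, h]

/-! ## Changing the normalisation -/

/-- `t^ε (log 1/t)^k → 0` as `t → 0⁺` for `ε > 0`. [folklore] -/
theorem tendsto_rpow_mul_log_pow {ε : ℝ} (hε : 0 < ε) (k : ℕ) :
    Tendsto (fun t : ℝ => t ^ ε * Real.log t⁻¹ ^ k) (𝓝[>] 0) (𝓝 0) := by
  have hlog : Tendsto (fun t : ℝ => Real.log t⁻¹) (𝓝[>] 0) atTop :=
    Real.tendsto_log_atTop.comp tendsto_inv_nhdsGT_zero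
  have h1 : Tendsto (fun s : ℝ => (ε * s) ^ k * Real.exp (-(ε * s))) atTop (𝓝 0) :=
    (Real.tendsto_pow_mul_exp_neg_atTop_nhds_zero k).comp (tendsto_id.const_mul_atTop hε)
  have h2 := (h1.comp hlog).mul_const ((ε ^ k)⁻¹)
  rw [zero_mul] at h2
  refine h2.congr' ?_
  filter_upwards [self_mem_nhdsWithin] with t (ht : 0 < t)
  simp only [Function.comp_apply]
  rw [mul_pow, Real.log_inv, mul_neg, neg_neg, Real.rpow_def_of_pos ht, mul_comm (Real.log t) ε]
  field_simp

/-- Passing to a lexicographically smaller scale kills the limit: if `V(t)/(t^a L^p) → C` and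
`b < a`, or `b = a` and `p < q`, then `V(t)/(t^b L^q) → 0` (`L = log 1/t`). [folklore] -/
theorem tendsto_renormalize_zero {V : ℝ → ℝ} {a b C : ℝ} {p q : ℕ}
    (hV : Tendsto (fun t => V t / (t ^ a * Real.log t⁻¹ ^ p)) (𝓝[>] 0) (𝓝 C))
    (h : b < a ∨ (b = a ∧ p < q)) :
    Tendsto (fun t => V t / (t ^ b * Real.log t⁻¹ ^ q)) (𝓝[>] 0) (𝓝 0) := by
  have hlog : Tendsto (fun t : ℝ => Real.log t⁻¹) (𝓝[>] 0) atTop :=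
    Real.tendsto_log_atTop.comp tendsto_inv_nhdsGT_zero
  -- the ratio of the two scales tends to zero
  have hR : Tendsto (fun t : ℝ => t ^ a * Real.log t⁻¹ ^ p / (t ^ b * Real.log t⁻¹ ^ q))
      (𝓝[>] 0) (𝓝 0) := by
    have hL1 : ∀ᶠ t : ℝ in 𝓝[>] 0, 1 ≤ Real.log t⁻¹ := hlog.eventually (eventually_ge_atTop 1)
    rcases h with hba | ⟨rfl, hpq⟩
    · have h0 := tendsto_rpow_mul_log_pow (sub_pos.2 hba) p
      refine tendsto_of_tendsto_of_tendsto_of_le_of_le' tendsto_const_nhds h0 ?_ ?_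
      · filter_upwards [self_mem_nhdsWithin, hL1] with t (ht : 0 < t) hL
        positivity
      · filter_upwards [self_mem_nhdsWithin, hL1] with t (ht : 0 < t) hL
        set L := Real.log t⁻¹ with hLdef
        have hLpos : 0 < L := by linarith
        have htb : 0 < t ^ b := Real.rpow_pos_of_pos ht b
        rw [Real.rpow_sub ht, div_mul_eq_mul_div, div_le_div_iff₀ (by positivity) htb]
        calc t ^ a * L ^ p * t ^ b = t ^ a * L ^ p * (t ^ b * 1) := by ring
          _ ≤ t ^ a * L ^ p * (t ^ b * L ^ q) := by
              gcongr
              exact one_le_pow₀ hL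
    · obtain ⟨m, rfl⟩ := Nat.exists_eq_add_of_lt hpq
      have h0 : Tendsto (fun t : ℝ => (Real.log t⁻¹ ^ (m + 1))⁻¹) (𝓝[>] 0) (𝓝 0) :=
        tendsto_inv_atTop_zero.comp ((tendsto_pow_atTop (by omega)).comp hlog)
      refine h0.congr' ?_
      filter_upwards [self_mem_nhdsWithin, hL1] with t (ht : 0 < t) hL
      set L := Real.log t⁻¹ with hLdef
      have hLpos : 0 < L := by linarith
      have htb : 0 < t ^ b := Real.rpow_pos_of_pos ht b
      rw [mul_div_mul_left _ _ htb.ne', show p + m + 1 = p + (m + 1) from by ring,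
        pow_add L p (m + 1), div_mul_cancel_left₀ (pow_ne_zero _ hLpos.ne')]
  have hmul := hV.mul hR
  rw [mul_zero] at hmul
  refine hmul.congr' ?_
  filter_upwards [self_mem_nhdsWithin, hlog.eventually (eventually_gt_atTop 0)] with t
    (ht : 0 < t) (hL : 0 < Real.log t⁻¹)
  set L := Real.log t⁻¹ with hLdef
  have hta : 0 < t ^ a := Real.rpow_pos_of_pos ht a
  have htb : 0 < t ^ b := Real.rpow_pos_of_pos ht b
  field_simp

/-! ## Normalised moments converge -/

/-- **Normalised moments of the sublevel sets converge**: for every multi-index `n` there is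
`c_n ≥ 0` with `∫_{x^κ ≤ t} x^n dvol_w / (t^λ (log 1/t)^{θ-1}) → c_n` as `t → 0⁺`
(`λ = rlct κ w`, `θ = rlctMult κ w`); `c_n > 0` exactly when the shifted weight `w + n` has the
same exponent pair. [folklore] -/
theorem tendsto_moment (hκ : κ ≠ 0) (hw : ∀ j, 0 < w j) (n : Fin d → ℕ) :
    ∃ c : ℝ, 0 ≤ c ∧ Tendsto (fun t : ℝ =>
      (∫ x in {x : Fin d → ℝ | ∏ j, x j ^ κ j ≤ t}, ∏ j, x j ^ n j
          ∂(Measure.pi fun j => powMeasure (w j))) /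
        (t ^ rlct κ w * Real.log t⁻¹ ^ (rlctMult κ w - 1))) (𝓝[>] 0) (𝓝 c) := by
  have hw' : ∀ j, 0 < w j + n j := fun j => add_pos_of_pos_of_nonneg (hw j) (Nat.cast_nonneg _)
  obtain ⟨C', hC', hV'⟩ := tendsto_sublevelVolume κ hw' hκ
  simp_rw [setIntegral_monomial_eq hw n (measurableSet_sublevel κ _)]
  rcases (rlct_le_rlct_add hκ hw n).eq_or_lt with hl | hl
  · rcases (rlctMult_add_le n hl.symm).eq_or_lt with hm | hm
    · refine ⟨C', hC'.le, ?_⟩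
      rw [hl, ← hm]
      exact hV'
    · refine ⟨0, le_rfl, tendsto_renormalize_zero hV' (Or.inr ⟨hl, ?_⟩)⟩
      have := rlctMult_pos (w := fun j => w j + n j) hκ
      omega
  · exact ⟨0, le_rfl, tendsto_renormalize_zero hV' (Or.inl hl)⟩

/-- The zeroth moment: the normalised volumes themselves converge to the positive constant of
`tendsto_sublevelVolume`, and are eventually bounded. [folklore] -/
theorem eventually_sublevelVolume_le (hκ : κ ≠ 0) (hw : ∀ j, 0 < w j) :
    ∃ M : ℝ, 0 < M ∧ ∀ᶠ t : ℝ in 𝓝[>] 0,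
      ((Measure.pi fun j => powMeasure (w j)) {x : Fin d → ℝ | ∏ j, x j ^ κ j ≤ t}).toReal /
        (t ^ rlct κ w * Real.log t⁻¹ ^ (rlctMult κ w - 1)) ≤ M := by
  obtain ⟨C, hC, hV⟩ := tendsto_sublevelVolume κ hw hκ
  exact ⟨C + 1, by linarith, (hV.eventually (eventually_le_nhds (by linarith : C < C + 1)))⟩

end Literature.Analysis.Asymptotics.MonomialPhase

end
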